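import Summits.CriticalPhenomena.PercolationContinuityZ3.Theorems.PercNearOneGluingNoHeavyQuantRootScaledExpansion
import Summits.CriticalPhenomena.PercolationContinuityZ3.Theorems.PercNearOneGluingNoHeavyQuantRootPatternRegating
import HarnessLib

/-!
# QUANT lane R8, T-DEC: THE TOP-LEVEL ROOT-SCALED EXPANSION, part 3 — THE RESIDUAL'S ROOT-PATTERN MIXTURE (R_a's pattern coefficients in the
# kernel, k-general, any root gates): `flaw L` and `flaw Lₐ` are mixtures of the SAME opened-sub-forest pieces, with the pattern-level weight
# comparisons behind (A)/(B); hence `resid a w L = ν₀·δ₀ + Σ ν_U·F_U` with explicit `ν_U ≥ 0` (lead g46 README V428 (2); arm-1 gen 48)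

builds on p205010 (kernel theorem, internal audit signed; external expert review pending)

Support file (`--supports stmt-CriticalPhenomena-4575`), QUANT lane seat prim-quant-arm-1 (gen 48, architect), rung R8 of
`run/shared/lean/prim/quant/LADDER.md`; memo `run/shared/lean/prim/quant/prim-quant-arm-1-g48/ARCH-G48.md` §2, §6.  Theorems only (no definitions, no
`@[conjecture]`), standard axioms, no sorries.  Sequel of `…QuantRootScaledExpansion` (✓ p414146: `Sib.scale`, `rfac`, `rprod`, `wco`, `resid`); uses typer
g39's root-pattern tools (`…QuantRootPatternRegating`: `Smin`, `Stot`, `xmin`, `lconv_top_left_of_le`) and list binder.  The DEC use of the mixture (the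
residual re-gates below the pair threshold; equal root gates with `q·Σmᵢ ≤ 2·min mᵢ` are SDEC) is the sequel `…QuantRootScaledEqualRoots`.

THE RESIDUAL'S PATTERNS (V428 (2) "R_a's pattern coefficients").  `flaw_scale_rootPattern`: the forest law `flaw L` and the root-scaled forest law
`flaw Lₐ` (`Lₐ = L.map (Sib.scale a)`) are mixtures of THE SAME pieces — `δ₀` and, for every non-empty open-root set `U`, the convolution `F_U` of the
OPENED sub-forests of `U` (tree-built at a floor `y_U ≥ xmin L`, `y_U > x`, with `m_U + |U| ≤ fgates L` gates, mean `s_U = Σ_U mᵢ`, `|U|·Smin L ≤ s_U ≤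
Stot L`) — with weights `π_U = Π_U qᵢ Π_{∉U}(1−qᵢ)` resp. `p_U = Π_U (aqᵢ) Π_{∉U}(1−aqᵢ)`, and THE WEIGHT COMPARISONS `π_∅ = rprod·p_∅`, `rprod·p_U ≤ π_U`,
`wco·p_U ≤ a·π_U` (the pattern-level content of part 1's (A)/(B): `c_U/p_U = a^{1−|U|}Π_{∉U} rᵢ ≥ wco`), `wco·p_∅ ≤ (1−a) + a·π_∅`, and, for EQUAL root
gates, `a·π_U = wco·p_U` on single-root pieces (the least singleton — every singleton when the gates are equal — is spent on the product part).  Hence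
(`resid_rootPattern`) **`resid a w L = ν_∅·δ₀ + Σ_U ν_U·F_U`, `ν_U = (a·π_U − w·p_U)/(1 − w) ≥ 0`, `ν_∅ = ((1−a) + aπ_∅ − w p_∅)/(1−w) ≥ 0`, total `1`,
`Σ ν_U s_U = a·fmean L`** (for `w ≤ wco a L`, `w < 1`), and with equal root gates and `w = wco a L` the single-root pieces carry NO weight.  The proof is
typer g39's `flaw_rootPattern` induction run on both lists at once (`lconv_mixture_gate` = one cons step of a mixture beside a gated tree).

* `wco_cons_le_rprod`, `wco_cons_of_const` (equal gates: `wco (s :: L) = rprod L = rfac s · wco L`); `lconv_mixture_gate`;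
* **`flaw_scale_rootPattern`** (the paired root-pattern mixture with the weight comparisons), **`resid_rootPattern`** (R_a's pattern mixture).

HONEST STATUS: the residual's pattern calculus, no certificate; `SiblingStep`, `GateStepN`, `FarTreeRow` OPEN; RATE class log\* / honest sentence of
`run/shared/lean/prim/quant/README.md` unchanged.  [this work]; root-pattern mixture: prim-quant-stmt g39 (lead g42's all-subsets opening); programme
(I)–(II): prim-quant-lead g46.  Nothing here is cited as a published result.  The gluing rows served [cite: KozmaNitzan2024, Conjecture 3 (p. 15)];
product measure [cite: Grimmett1999, §1.3 p. 10].
-/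

noncomputable section

open scoped BigOperators

namespace Summit.CriticalPhenomena.PercolationContinuityZ3.Theorems
namespace Quant
namespace LawDec

open Finset

/-! ### Tools -/

/-- `wco (s :: L) ≤ rprod L` (for `L = []` both are `1`). [this work] -/
theorem wco_cons_le_rprod (a : ℝ) (s : Sib) : ∀ L : List Sib, wco a (s :: L) ≤ rprod a L
  | [] => by simp [wco, rprod]
  | t :: L => (wco_cons_cons_le a s t L).1

/-- for EQUAL root gates the weight recursion collapses: `wco (s :: L) = rprod L`, and `= rfac s · wco L` when `L ≠ []`. [this work] -/
theorem wco_cons_of_const (a q₀ : ℝ) :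
    ∀ (L : List Sib) (s : Sib), (∀ u ∈ s :: L, u.q = q₀) → wco a (s :: L) = rprod a L ∧ (L ≠ [] → wco a (s :: L) = rfac a s * wco a L)
  | [], s, _ => by simp [wco, rprod]
  | t :: L, s, h => by
    have hs : s.q = q₀ := h s List.mem_cons_self
    have ht : t.q = q₀ := h t (List.mem_cons_of_mem s List.mem_cons_self)
    have ih := (wco_cons_of_const a q₀ L t (fun u hu => h u (List.mem_cons_of_mem s hu))).1
    have hr : rfac a s = rfac a t := by simp only [rfac, hs, ht]
    have e : wco a (s :: t :: L) = rprod a (t :: L) := by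
      simp only [wco, ih, rprod, hr, min_self]
    exact ⟨e, fun _ => by rw [e, ih, hr]; simp only [rprod]⟩


/-- **one cons step of a mixture**: if `μ = π₀·δ₀ + Σ πᵢ Fᵢ` (pieces vanishing above `tᵢ ≤ T`), then beside a gated tree
`μ ∗ gate ρ q = π₀(1−q)·δ₀ + Σᵢ [q πᵢ·(Fᵢ ∗ ρ) + (1−q)πᵢ·Fᵢ] + π₀ q·ρ`. [this work] -/
theorem lconv_mixture_gate {ι : Type} [Fintype ι] (T M : ℕ) (μ ρ : ℕ → ℝ) (q π₀ : ℝ) (π : ι → ℝ) (F : ι → ℕ → ℝ) (t : ι → ℕ)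
    (hmix : ∀ h, μ h = π₀ * (if h = 0 then (1 : ℝ) else 0) + ∑ i, π i * F i h)
    (ht : ∀ i, t i ≤ T) (hFM : ∀ i h, t i < h → F i h = 0) (ρM : ∀ h, M < h → ρ h = 0) (h : ℕ) :
    lconv T M μ (gate ρ q) h
      = (π₀ * (1 - q)) * (if h = 0 then (1 : ℝ) else 0)
        + ∑ i, ((q * π i) * lconv (t i) M (F i) ρ h + ((1 - q) * π i) * F i h) + (π₀ * q) * ρ h := by
  have e1 : μ = fun k => π₀ * (fun k => if k = 0 then (1 : ℝ) else 0) k + 1 * (fun k => ∑ i, π i * F i k) k := by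
    funext k; rw [hmix k]; ring
  have e2 : gate ρ q = fun k => q * ρ k + (1 - q) * (fun k => if k = 0 then (1 : ℝ) else 0) k :=
    funext fun k => gate_apply ρ q k
  rw [e1, lconv_lin_left, e2, lconv_lin_right, lconv_lin_right, lconv_fsum_left, lconv_fsum_left]
  have A : lconv T M (fun k => if k = 0 then (1 : ℝ) else 0) ρ h = ρ h := lconv_delta_left _ _ _ ρM h
  have B : lconv T M (fun k => if k = 0 then (1 : ℝ) else 0) (fun k => if k = 0 then (1 : ℝ) else 0) h
      = (if h = 0 then (1 : ℝ) else 0) := lconv_delta_left _ _ _ (fun k hk => if_neg (by omega)) h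
  have C : ∀ i, lconv T M (F i) ρ h = lconv (t i) M (F i) ρ h :=
    fun i => lconv_top_left_of_le (t i) T M (F i) ρ (ht i) (hFM i) h
  have D : ∀ i, lconv T M (F i) (fun k => if k = 0 then (1 : ℝ) else 0) h = F i h :=
    fun i => lconv_delta_right _ _ _ (fun k hk => hFM i k (lt_of_le_of_lt (ht i) hk)) h
  rw [A, B]
  simp_rw [C, D]
  rw [Finset.sum_add_distrib]
  have n1 : ∑ i, q * π i * lconv (t i) M (F i) ρ h = q * ∑ i, π i * lconv (t i) M (F i) ρ h := by
    rw [Finset.mul_sum]; exact Finset.sum_congr rfl fun i _ => by ring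
  have n2 : ∑ i, (1 - q) * π i * F i h = (1 - q) * ∑ i, π i * F i h := by
    rw [Finset.mul_sum]; exact Finset.sum_congr rfl fun i _ => by ring
  rw [n1, n2]
  ring

/-! ### The paired root-pattern mixture -/

/-- **THE PAIRED ROOT-PATTERN MIXTURE.**  For tree-built siblings at floor `0 < x < 1` and `0 < a ≤ 1`: `flaw L = π₀·δ₀ + Σ πᵢ Fᵢ` and
`flaw Lₐ = p₀·δ₀ + Σ pᵢ Fᵢ` with THE SAME pieces (open-root sets `U ≠ ∅`: `Fᵢ` = convolution of the opened sub-forests of `U`, a probability law on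
`{0..tᵢ}`, `tᵢ ≤ ftop L`, of mean `sᵢ` with `cᵢ·Smin L ≤ sᵢ ≤ Stot L` where `cᵢ = |U| ≥ 1`, tree-built at a floor `yᵢ ≥ xmin L`, `yᵢ > x`, with `mᵢ + cᵢ ≤ fgates L`
gates), nonnegative weights of total `1`, means `Σ πᵢsᵢ = fmean L`, `Σ pᵢsᵢ = a·fmean L`, and THE WEIGHT COMPARISONS `π₀ = rprod·p₀`, `rprod·pᵢ ≤ πᵢ`,
`wco·pᵢ ≤ a·πᵢ`, `wco·p₀ ≤ (1−a) + a·π₀`, and for EQUAL root gates `a·πᵢ = wco·pᵢ` on the single-root pieces. [this work] -/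
theorem flaw_scale_rootPattern {x a : ℝ} (hx0 : 0 < x) (hx1 : x < 1) (ha0 : 0 < a) (ha1 : a ≤ 1) (L : List Sib)
    (hL : ∀ s ∈ L, s.TreeOK x) :
    ∃ (π₀ p₀ : ℝ) (ι : Type) (_ : Fintype ι) (π p : ι → ℝ) (c t m : ι → ℕ) (s y : ι → ℝ) (F : ι → ℕ → ℝ),
      0 ≤ π₀ ∧ (∀ i, 0 ≤ π i) ∧ (π₀ + ∑ i, π i = 1) ∧ 0 ≤ p₀ ∧ (∀ i, 0 ≤ p i) ∧ (p₀ + ∑ i, p i = 1) ∧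
      (∀ h, flaw L h = π₀ * (if h = 0 then (1 : ℝ) else 0) + ∑ i, π i * F i h) ∧
      (∀ h, flaw (L.map (Sib.scale a)) h = p₀ * (if h = 0 then (1 : ℝ) else 0) + ∑ i, p i * F i h) ∧
      (∑ i, π i * s i = fmean L) ∧ (∑ i, p i * s i = a * fmean L) ∧
      π₀ = rprod a L * p₀ ∧ wco a L * p₀ ≤ (1 - a) + a * π₀ ∧
      (∀ i, rprod a L * p i ≤ π i ∧ wco a L * p i ≤ a * π i ∧
        (∀ q₀ : ℝ, (∀ u ∈ L, u.q = q₀) → c i = 1 → a * π i = wco a L * p i)) ∧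
      (∀ i, t i ≤ ftop L ∧ (∀ h, 0 ≤ F i h) ∧ (∀ h, t i < h → F i h = 0) ∧ (∑ h ∈ Finset.range (t i + 1), F i h = 1) ∧
        (∑ h ∈ Finset.range (t i + 1), (h : ℝ) * F i h = s i) ∧ 1 ≤ c i ∧ Smin L ≤ s i ∧ (c i : ℝ) * Smin L ≤ s i ∧ s i ≤ Stot L ∧
        TreeBuiltN (y i) (m i) (t i) (F i) ∧ xmin L ≤ y i ∧ x < y i ∧ y i * (t i : ℝ) ≤ s i ∧ m i + c i ≤ fgates L) := by
  classical
  induction L with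
  | nil =>
    refine ⟨1, 1, Fin 0, inferInstance, fun _ => 0, fun _ => 0, fun _ => 0, fun _ => 0, fun _ => 0, fun _ => 0, fun _ => 0,
      fun _ => fun _ => 0, zero_le_one, fun _ => le_rfl, by simp, zero_le_one, fun _ => le_rfl, by simp, fun h => by simp [flaw],
      fun h => by simp [flaw], by simp [fmean], by simp [fmean], by simp [rprod], by simp [wco], fun i => i.elim0, fun i => i.elim0⟩
  | cons s L ih =>
    have hsT := hL s List.mem_cons_self
    obtain ⟨hq0, hq1, hxq, hT, _⟩ := hsT
    obtain ⟨hx₁0, hx₁1, ρ0, ρM, ρ1, ρta⟩ := hT.lawFacts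
    have hsL : ∀ t ∈ L, t.TreeOK x := fun t ht => hL t (List.mem_cons_of_mem s ht)
    obtain ⟨π₀, p₀, ι, _, π, p, c, t, m, σ, y, F, hπ00, hπ0, hπ1, hp00, hp0, hp1, hmix, hmixa, hπσ, hpσ, hπp0, _, hW, hP⟩ := ih hsL
    have hxx₁ : x < s.x₁ := lt_of_le_of_lt hxq (by nlinarith)
    have haq0 : 0 < a * s.q := mul_pos ha0 hq0
    have haq1 : a * s.q < 1 := by nlinarith
    obtain ⟨_, _, hrq, har, _⟩ := rfac_facts ha1 (hL s List.mem_cons_self).lawOK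
    obtain ⟨hP0, _⟩ := rprod_facts ha1 L (fun t ht => (hsL t ht).lawOK)
    have hwP : wco a (s :: L) ≤ rprod a L := wco_cons_le_rprod a s L
    have hStot0 : 0 ≤ Stot L := Stot_nonneg L (fun t ht => (hsL t ht).lawOK)
    have hSpos : 0 ≤ s.mean := (s.mean_pos (hL s List.mem_cons_self)).le
    have hπ0le : π₀ ≤ 1 := by
      have : 0 ≤ ∑ i, π i := Finset.sum_nonneg fun i _ => hπ0 i
      linarith
    -- a piece index certifies `L ≠ []`
    have hneOf : ι → L ≠ [] := by
      intro i; rintro rfl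
      have := (hP i).2.2.2.2.2.2.2.2.2.2.2.2.2
      simp [fgates] at this
      have := (hP i).2.2.2.2.2.1
      omega
    refine ⟨π₀ * (1 - s.q), p₀ * (1 - a * s.q), (Bool × ι) ⊕ Unit, inferInstance,
      Sum.elim (fun b => (if b.1 then s.q else 1 - s.q) * π b.2) (fun _ => π₀ * s.q),
      Sum.elim (fun b => (if b.1 then a * s.q else 1 - a * s.q) * p b.2) (fun _ => p₀ * (a * s.q)),
      Sum.elim (fun b => if b.1 then c b.2 + 1 else c b.2) (fun _ => 1),
      Sum.elim (fun b => if b.1 then t b.2 + s.M else t b.2) (fun _ => s.M),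
      Sum.elim (fun b => if b.1 then m b.2 + s.n else m b.2) (fun _ => s.n),
      Sum.elim (fun b => if b.1 then σ b.2 + s.mean else σ b.2) (fun _ => s.mean),
      Sum.elim (fun b => if b.1 then min (y b.2) s.x₁ else y b.2) (fun _ => s.x₁),
      Sum.elim (fun b => if b.1 then lconv (t b.2) s.M (F b.2) s.ρ else F b.2) (fun _ => s.ρ),
      mul_nonneg hπ00 (by linarith), ?_, ?_, mul_nonneg hp00 (by linarith), ?_, ?_, ?_, ?_, ?_, ?_, ?_, ?_, ?_, ?_⟩
    · -- `π ≥ 0`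
      rintro (⟨b, i⟩ | u)
      · cases b <;> simp only [Sum.elim_inl, Bool.false_eq_true, if_false, if_true] <;> nlinarith [hπ0 i]
      · simp only [Sum.elim_inr]; exact mul_nonneg hπ00 hq0.le
    · -- `Σ π = 1`
      simp only [Fintype.sum_sum_type, Fintype.sum_prod_type, Fintype.sum_bool, Sum.elim_inl, Sum.elim_inr, if_true, Bool.false_eq_true,
        if_false, Finset.univ_unique, Finset.sum_singleton]
      rw [← Finset.sum_add_distrib]
      have e : ∀ i, s.q * π i + (1 - s.q) * π i = π i := fun i => by ring
      simp_rw [e]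
      linarith [hπ1]
    · -- `p ≥ 0`
      rintro (⟨b, i⟩ | u)
      · cases b <;> simp only [Sum.elim_inl, Bool.false_eq_true, if_false, if_true] <;> nlinarith [hp0 i]
      · simp only [Sum.elim_inr]; exact mul_nonneg hp00 haq0.le
    · -- `Σ p = 1`
      simp only [Fintype.sum_sum_type, Fintype.sum_prod_type, Fintype.sum_bool, Sum.elim_inl, Sum.elim_inr, if_true, Bool.false_eq_true,
        if_false, Finset.univ_unique, Finset.sum_singleton]
      rw [← Finset.sum_add_distrib]
      have e : ∀ i, a * s.q * p i + (1 - a * s.q) * p i = p i := fun i => by ring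
      simp_rw [e]
      linarith [hp1]
    · -- the mixture identity for `flaw (s :: L)`
      intro h
      have key := lconv_mixture_gate (ftop L) s.M (flaw L) s.ρ s.q π₀ π F t hmix (fun i => (hP i).1) (fun i k hk => (hP i).2.2.1 k hk) ρM h
      rw [show flaw (s :: L) h = lconv (ftop L) s.M (flaw L) (gate s.ρ s.q) h from rfl, key]
      simp only [Fintype.sum_sum_type, Fintype.sum_prod_type, Fintype.sum_bool, Sum.elim_inl, Sum.elim_inr, if_true,
        Bool.false_eq_true, if_false, Finset.univ_unique, Finset.sum_singleton, Finset.sum_add_distrib]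
      ring
    · -- the mixture identity for `flaw (s :: L)ₐ`
      intro h
      have key := lconv_mixture_gate (ftop L) s.M (flaw (L.map (Sib.scale a))) s.ρ (a * s.q) p₀ p F t hmixa (fun i => (hP i).1)
        (fun i k hk => (hP i).2.2.1 k hk) ρM h
      rw [flaw_map_scale_cons, key]
      simp only [Fintype.sum_sum_type, Fintype.sum_prod_type, Fintype.sum_bool, Sum.elim_inl, Sum.elim_inr, if_true,
        Bool.false_eq_true, if_false, Finset.univ_unique, Finset.sum_singleton, Finset.sum_add_distrib]
      ring
    · -- `Σ πσ = fmean`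
      simp only [fmean, Fintype.sum_sum_type, Fintype.sum_prod_type, Fintype.sum_bool, Sum.elim_inl, Sum.elim_inr, if_true,
        Bool.false_eq_true, if_false, Finset.univ_unique, Finset.sum_singleton]
      rw [← Finset.sum_add_distrib]
      have e : ∀ i, s.q * π i * (σ i + s.mean) + (1 - s.q) * π i * σ i = π i * σ i + (s.q * s.mean) * π i := fun i => by ring
      simp_rw [e]
      rw [Finset.sum_add_distrib, ← Finset.mul_sum, hπσ]
      have : ∑ i, π i = 1 - π₀ := by linarith [hπ1]
      rw [this]; ring
    · -- `Σ pσ = a·fmean`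
      simp only [fmean, Fintype.sum_sum_type, Fintype.sum_prod_type, Fintype.sum_bool, Sum.elim_inl, Sum.elim_inr, if_true,
        Bool.false_eq_true, if_false, Finset.univ_unique, Finset.sum_singleton]
      rw [← Finset.sum_add_distrib]
      have e : ∀ i, a * s.q * p i * (σ i + s.mean) + (1 - a * s.q) * p i * σ i = p i * σ i + (a * s.q * s.mean) * p i :=
        fun i => by ring
      simp_rw [e]
      rw [Finset.sum_add_distrib, ← Finset.mul_sum, hpσ]
      have : ∑ i, p i = 1 - p₀ := by linarith [hp1]
      rw [this]; ring
    · -- `π₀ = rprod·p₀`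
      simp only [rprod]
      rw [hπp0]
      calc rprod a L * p₀ * (1 - s.q) = rprod a L * p₀ * (rfac a s * (1 - a * s.q)) := by rw [hrq]
        _ = rfac a s * rprod a L * (p₀ * (1 - a * s.q)) := by ring
    · -- `wco·p₀ ≤ (1−a) + a·π₀`
      have h1 : wco a (s :: L) * (p₀ * (1 - a * s.q)) ≤ rprod a L * (p₀ * (1 - a * s.q)) :=
        mul_le_mul_of_nonneg_right hwP (mul_nonneg hp00 (sub_nonneg.2 haq1.le))
      have h2 : rprod a L * (p₀ * (1 - a * s.q)) = (1 - a * s.q) * π₀ := by rw [hπp0]; ring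
      nlinarith [mul_nonneg (sub_nonneg.2 ha1) (sub_nonneg.2 hπ0le)]
    · -- the weight comparisons per piece
      rintro (⟨b, i⟩ | u)
      · obtain ⟨hW1, hW2, hW3⟩ := hW i
        have hne : L ≠ [] := hneOf i
        have hci : 1 ≤ c i := (hP i).2.2.2.2.2.1
        have hpi : 0 ≤ p i := hp0 i
        cases b
        · -- absent
          simp only [Sum.elim_inl, Bool.false_eq_true, if_false]
          obtain ⟨t', L', rfl⟩ : ∃ t' L', L = t' :: L' := by
            cases L with
            | nil => exact absurd rfl hne
            | cons t' L' => exact ⟨t', L', rfl⟩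
          have hwW : wco a (s :: t' :: L') ≤ rfac a s * wco a (t' :: L') := (wco_cons_cons_le a s t' L').2
          refine ⟨?_, ?_, fun q₀ hq hc1 => ?_⟩
          · simp only [rprod]
            calc rfac a s * rprod a (t' :: L') * ((1 - a * s.q) * p i)
                = (rfac a s * (1 - a * s.q)) * (rprod a (t' :: L') * p i) := by ring
              _ = (1 - s.q) * (rprod a (t' :: L') * p i) := by rw [hrq]
              _ ≤ (1 - s.q) * π i := mul_le_mul_of_nonneg_left hW1 (by linarith)
          · calc wco a (s :: t' :: L') * ((1 - a * s.q) * p i)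
                ≤ (rfac a s * wco a (t' :: L')) * ((1 - a * s.q) * p i) :=
                  mul_le_mul_of_nonneg_right hwW (mul_nonneg (sub_nonneg.2 haq1.le) hpi)
              _ = (rfac a s * (1 - a * s.q)) * (wco a (t' :: L') * p i) := by ring
              _ = (1 - s.q) * (wco a (t' :: L') * p i) := by rw [hrq]
              _ ≤ (1 - s.q) * (a * π i) := mul_le_mul_of_nonneg_left hW2 (by linarith)
              _ = a * ((1 - s.q) * π i) := by ring
          · have hWe := hW3 q₀ (fun u hu => hq u (List.mem_cons_of_mem s hu)) hc1
            have hwe : wco a (s :: t' :: L') = rfac a s * wco a (t' :: L') := (wco_cons_of_const a q₀ (t' :: L') s hq).2 hne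
            rw [hwe]
            calc a * ((1 - s.q) * π i) = (1 - s.q) * (a * π i) := by ring
              _ = (rfac a s * (1 - a * s.q)) * (wco a (t' :: L') * p i) := by rw [hrq, hWe]
              _ = rfac a s * wco a (t' :: L') * ((1 - a * s.q) * p i) := by ring
        · -- open
          simp only [Sum.elim_inl, if_true]
          refine ⟨?_, ?_, fun q₀ _ hc1 => absurd hc1 (by omega)⟩
          · simp only [rprod]
            have hnn : 0 ≤ s.q * (rprod a L * p i) := mul_nonneg hq0.le (mul_nonneg hP0.le hpi)
            calc rfac a s * rprod a L * (a * s.q * p i) = (a * rfac a s) * (s.q * (rprod a L * p i)) := by ring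
              _ ≤ 1 * (s.q * (rprod a L * p i)) := mul_le_mul_of_nonneg_right har hnn
              _ = s.q * (rprod a L * p i) := one_mul _
              _ ≤ s.q * π i := mul_le_mul_of_nonneg_left hW1 hq0.le
          · calc wco a (s :: L) * (a * s.q * p i) ≤ rprod a L * (a * s.q * p i) :=
                  mul_le_mul_of_nonneg_right hwP (mul_nonneg haq0.le hpi)
              _ = a * (s.q * (rprod a L * p i)) := by ring
              _ ≤ a * (s.q * π i) := mul_le_mul_of_nonneg_left (mul_le_mul_of_nonneg_left hW1 hq0.le) ha0.le
      · -- `s` open alone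
        simp only [Sum.elim_inr]
        refine ⟨?_, ?_, fun q₀ hq _ => ?_⟩
        · simp only [rprod]
          rw [hπp0]
          have hnn : 0 ≤ s.q * (rprod a L * p₀) := mul_nonneg hq0.le (mul_nonneg hP0.le hp00)
          calc rfac a s * rprod a L * (p₀ * (a * s.q)) = (a * rfac a s) * (s.q * (rprod a L * p₀)) := by ring
            _ ≤ 1 * (s.q * (rprod a L * p₀)) := mul_le_mul_of_nonneg_right har hnn
            _ = rprod a L * p₀ * s.q := by ring
        · rw [hπp0]
          calc wco a (s :: L) * (p₀ * (a * s.q)) ≤ rprod a L * (p₀ * (a * s.q)) :=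
                mul_le_mul_of_nonneg_right hwP (mul_nonneg hp00 haq0.le)
            _ = a * (rprod a L * p₀ * s.q) := by ring
        · rw [hπp0, (wco_cons_of_const a q₀ L s hq).1]; ring
    · -- piece facts
      rintro (⟨b, i⟩ | u)
      · obtain ⟨hti, F0, FM, F1, Fmean, hci, hSmin, hcS, hStot, hTF, hxm, hxy, hyt, hmg⟩ := hP i
        obtain ⟨hy0', hy1', _, _, _, _⟩ := hTF.lawFacts
        have hne : L ≠ [] := hneOf i
        have hSle : Smin (s :: L) ≤ Smin L := (Smin_cons_le s L).2 hne
        have hSs : Smin (s :: L) ≤ s.mean := (Smin_cons_le s L).1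
        cases b
        · -- absent: the piece is unchanged
          simp only [Sum.elim_inl, Bool.false_eq_true, if_false]
          refine ⟨by simp only [ftop]; omega, F0, FM, F1, Fmean, hci, hSle.trans hSmin, ?_, by simp only [Stot]; linarith, hTF,
            by simp only [xmin]; exact (min_le_right _ _).trans hxm, hxy, hyt, by simp only [fgates]; omega⟩
          have : (c i : ℝ) * Smin (s :: L) ≤ (c i : ℝ) * Smin L := mul_le_mul_of_nonneg_left hSle (Nat.cast_nonneg _)
          linarith
        · -- open: the piece convolved with the opened sub-forest
          simp only [Sum.elim_inl, if_true]
          have hy'0 : 0 < min (y i) s.x₁ := lt_min hy0' hx₁0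
          have hTF' : TreeBuiltN (min (y i) s.x₁) (m i + s.n) (t i + s.M) (lconv (t i) s.M (F i) s.ρ) :=
            TreeBuiltN.conv (TreeBuiltN.mono hTF hy'0 (min_le_left _ _)) (TreeBuiltN.mono hT hy'0 (min_le_right _ _))
          obtain ⟨_, _, G0, GM, G1, Gta⟩ := hTF'.lawFacts
          refine ⟨by simp only [ftop]; omega, G0, GM, G1, ?_, by omega, by linarith, ?_, by simp only [Stot]; linarith, hTF', ?_,
            lt_min hxy hxx₁, ?_, by simp only [fgates]; omega⟩
          · rw [sum_mul_lconv _ _ _ _ F1 ρ1, Fmean]; rfl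
          · have : (c i : ℝ) * Smin (s :: L) ≤ (c i : ℝ) * Smin L := mul_le_mul_of_nonneg_left hSle (Nat.cast_nonneg _)
            push_cast
            linarith
          · simp only [xmin]; exact min_le_min hxm le_rfl |>.trans' (by rw [min_comm])
          · rw [sum_mul_lconv _ _ _ _ F1 ρ1, Fmean] at Gta; exact Gta
      · -- `s` open alone
        simp only [Sum.elim_inr]
        refine ⟨by simp only [ftop]; omega, ρ0, ρM, ρ1, rfl, le_rfl, (Smin_cons_le s L).1, by rw [Nat.cast_one, one_mul]; exact (Smin_cons_le s L).1,
          by simp only [Stot]; linarith, hT, by simp only [xmin]; exact min_le_left _ _, hxx₁, ρta, by simp only [fgates]; omega⟩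

/-- **THE RESIDUAL'S ROOT-PATTERN MIXTURE (R_a's pattern coefficients).**  For tree-built siblings at floor `0 < x < 1`, `0 < a ≤ 1` and a weight
`w ≤ wco a L`, `w < 1`: `resid a w L = ν₀·δ₀ + Σ νᵢ Fᵢ` over the root-pattern pieces of `flaw_scale_rootPattern` (`νᵢ = (a πᵢ − w pᵢ)/(1−w) ≥ 0`,
`ν₀ ≥ 0`, total `1`, `Σ νᵢsᵢ = a·fmean L`), and for EQUAL root gates with `w = wco a L` the single-root pieces (`cᵢ = 1`) carry no weight. [this work] -/
theorem resid_rootPattern {x a w : ℝ} (hx0 : 0 < x) (hx1 : x < 1) (ha0 : 0 < a) (ha1 : a ≤ 1) (L : List Sib)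
    (hL : ∀ s ∈ L, s.TreeOK x) (hw : w ≤ wco a L) (hw1 : w < 1) :
    ∃ (ν₀ : ℝ) (ι : Type) (_ : Fintype ι) (ν : ι → ℝ) (c t m : ι → ℕ) (s y : ι → ℝ) (F : ι → ℕ → ℝ),
      0 ≤ ν₀ ∧ (∀ i, 0 ≤ ν i) ∧ (ν₀ + ∑ i, ν i = 1) ∧
      (∀ h, resid a w L h = ν₀ * (if h = 0 then (1 : ℝ) else 0) + ∑ i, ν i * F i h) ∧ (∑ i, ν i * s i = a * fmean L) ∧
      (∀ q₀ : ℝ, (∀ u ∈ L, u.q = q₀) → w = wco a L → ∀ i, c i = 1 → ν i = 0) ∧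
      (∀ i, t i ≤ ftop L ∧ (∀ h, 0 ≤ F i h) ∧ (∀ h, t i < h → F i h = 0) ∧ (∑ h ∈ Finset.range (t i + 1), F i h = 1) ∧
        (∑ h ∈ Finset.range (t i + 1), (h : ℝ) * F i h = s i) ∧ 1 ≤ c i ∧ Smin L ≤ s i ∧ (c i : ℝ) * Smin L ≤ s i ∧ s i ≤ Stot L ∧
        TreeBuiltN (y i) (m i) (t i) (F i) ∧ xmin L ≤ y i ∧ x < y i ∧ y i * (t i : ℝ) ≤ s i ∧ m i + c i ≤ fgates L) := by
  obtain ⟨π₀, p₀, ι, _, π, p, c, t, m, s, y, F, hπ00, hπ0, hπ1, hp00, hp0, hp1, hmix, hmixa, hπs, hps, _, hw0', hW, hP⟩ :=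
    flaw_scale_rootPattern hx0 hx1 ha0 ha1 L hL
  have h1w : 0 < 1 - w := by linarith
  have hne : (1 - w) ≠ 0 := h1w.ne'
  refine ⟨((1 - a) + a * π₀ - w * p₀) / (1 - w), ι, inferInstance, fun i => (a * π i - w * p i) / (1 - w), c, t, m, s, y, F,
    ?_, fun i => ?_, ?_, fun h => ?_, ?_, fun q₀ hq hwe i hci => ?_, hP⟩
  · refine div_nonneg ?_ h1w.le
    nlinarith [mul_le_mul_of_nonneg_right hw hp00]
  · refine div_nonneg ?_ h1w.le
    nlinarith [mul_le_mul_of_nonneg_right hw (hp0 i), (hW i).2.1]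
  · rw [← Finset.sum_div, ← add_div, div_eq_one_iff_eq hne, Finset.sum_sub_distrib, ← Finset.mul_sum, ← Finset.mul_sum]
    have e1 : ∑ i, π i = 1 - π₀ := by linarith [hπ1]
    have e2 : ∑ i, p i = 1 - p₀ := by linarith [hp1]
    rw [e1, e2]; ring
  · simp only [resid]
    rw [gate_apply, hmix h, hmixa h, div_eq_iff hne, add_mul, Finset.sum_mul]
    have e : ∀ i, (a * π i - w * p i) / (1 - w) * F i h * (1 - w) = a * (π i * F i h) - w * (p i * F i h) := by
      intro i; rw [div_mul_eq_mul_div, div_mul_cancel₀ _ hne]; ring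
    simp_rw [e]
    rw [Finset.sum_sub_distrib, ← Finset.mul_sum, ← Finset.mul_sum,
      show ((1 - a) + a * π₀ - w * p₀) / (1 - w) * (if h = 0 then (1 : ℝ) else 0) * (1 - w)
        = ((1 - a) + a * π₀ - w * p₀) * (if h = 0 then (1 : ℝ) else 0) by rw [div_mul_eq_mul_div, div_mul_cancel₀ _ hne]]
    ring
  · have e : ∀ i, (a * π i - w * p i) / (1 - w) * s i = (a * (π i * s i) - w * (p i * s i)) / (1 - w) := fun i => by ring
    simp_rw [e]
    rw [← Finset.sum_div, Finset.sum_sub_distrib, ← Finset.mul_sum, ← Finset.mul_sum, hπs, hps, div_eq_iff hne]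
    ring
  · rw [div_eq_zero_iff]; left
    rw [hwe, (hW i).2.2 q₀ hq hci]; ring


end LawDec
end Quant
end Summit.CriticalPhenomena.PercolationContinuityZ3.Theorems
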